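import Summits.QuantumFields.YangMills.Theorems.UnitScaleTiltProp7TrueAvgBudgetCentral
import Summits.QuantumFields.YangMills.Theorems.UnitScaleTiltProp7TrueAvgBudgetFlat
import HarnessLib

/-!
# Route `UnitScaleTilt`, crux K1 «MinimiserStabilityRegPr» (stmt-QuantumFields-19200), stub `stub_existenceMinimalOrbit` (EX), LANE II (B4★)∕(QB) —
# ★★★ THE CENTRAL SECTOR OF (QB) AT `W ∈ 𝔘_k(ε₀)`, CLOSED BY NAME: for every scalar bond field `c`,
# `Σ_ĉ ‖Q^{(K−n)}(c·1) ĉ‖² ≤ 2·Σ_{c′} ‖QTw W (c·1) c′‖²_F + Cq(L)·ℓ·(CURL_HS(W, c·1) + DIV_HS(W, c·1)) + Cq′·e·ℓ⁻¹·Σ_b‖c b·1‖²` (`hQB`'s instance `A := c·1`)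

Cell `ym3-torus` (HUMAN RULING D-0037, YM ladder rung R3 — YM₃ on T³ is a rung, NOT d = 4, NOT infinite volume, NOT a mass gap, NOT Clay; the YM gap is NOT proved),
width seat `ym3-torus-px19` (gen 7; lineage pen (QB)).  THEOREMS ONLY (0 `def`, 0 `sorry`); `--supports stmt-QuantumFields-19200 --as helper`, count-neutral; nothing here
claims the stub, the crux or any summit statement.

THE KNIT.  px10's ✓`Prop7TrueAvgBudgetCentral.trueAvgBudget_smul_one_of_flat` ((QB) on the centre does not see the background: ✓`Prop7TrueLinCentralRegPr`, ✓`Prop7QTwCentralSectorRegPr`,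
the flat stencils of (3.4)∕(3.8)) reduces the central (QB) row at `W ∈ RegPr F n K e` (`0 < e`, `10⁷L³e ≤ 1`) to the same row at `W = 1` with the flat true-linearised family;
px19's ✓`Prop7TrueAvgBudgetFlat.trueAvgBudget_smul_one_flat` IS that flat row (every direction, in particular the central ones), and ✓`Prop7CurvedLandauRowA.exists_trueLinIter_family 1`
supplies the flat family.  Composition by `exact`; the constant is (QB-flat)'s `Cq(L) = 2·Cr(L)` (L-only), `Cq′ ≥ 0` is free (the mass slot is not used on the centre).

WHAT IS PROVED (ns `…Theorems.Prop7TrueAvgBudgetCentralRegPr`): ★★★`trueAvgBudget_smul_one_of_regPr` — `∀ L > 1, ∃ Cq ≥ 0, ∀ F (F.L = L) n K (n < K) e (0 < e) (10⁷L³e ≤ 1)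
W (RegPr F n K e W) Q (hQ0) (hQs = hQB's recursion text) (Cq′ ≥ 0) (c : PBond (F.P K) 0 → ℂ), ⟨hQB's inequality at A := fun b ↦ c b • 1 with (Cq, Cq′)⟩`.
HONEST SCOPE.  The central sector only; the traceless sector of (QB) (✓`Prop7LegLemmaQTw` ⊕ curved (R-LEGS), w4-20520's pen ⊕ (QE′-H¹) ✓p714800∕✓p715779) and the sector
split are NOT here; nothing of (ENG)∕(REC)∕`hN06`∕EX∕the crux is proved; nothing continuum ∕ OS ∕ mass-gap ∕ Clay.

References: T. Bałaban, CMP **99** (1985) 389–434 [Balaban1985BackgroundPropagators] ((3.4) p.391, (3.8) p.392, (3.13)–(3.15) p.393); CMP **95** (1984) 17–40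
[Balaban1984PropagatorsI] ((1.18)–(1.21) pp.19–21); CMP **102** (1985) 277–309 [Balaban1985Variational] ((14) p.280, (44) p.285).
-/

set_option autoImplicit false

noncomputable section

open scoped BigOperators Matrix.Norms.L2Operator Matrix

namespace Summit.QuantumFields.YangMills.Theorems.Prop7TrueAvgBudgetCentralRegPr

open Literature.MathematicalPhysics.QuantumFieldTheory.Balaban1983to89
open Literature.MathematicalPhysics.QuantumFieldTheory.Balaban1983to89.T3ContinuumYM3Torus
open Literature.MathematicalPhysics.QuantumFieldTheory.Balaban1983to89.T3PrintedRegularMinimiser (RegPr)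
open T4Continuum BlockAveraging AveragingRT ExpMeanLog BlockAveragingEMLLinearised BlockAveragingEMLLinearisedBackground
open B9Eq39Adjoint (curl divB)
open B10Eq27TorusAxialLog (unitsField toUField)
open B9TorusCalculus (torusT)
open Summit.QuantumFields.YangMills.Theorems.Prop7SectET3HilbertLetters (W₂ frobEquiv)
open Summit.QuantumFields.YangMills.Theorems.Prop7SymAvgTw (QTw)
open Summit.QuantumFields.YangMills.Theorems.Prop7CurvedLandauRowA (exists_trueLinIter_family)
open Summit.QuantumFields.YangMills.Theorems.Prop7TrueAvgBudgetCentral (trueAvgBudget_smul_one_of_flat)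
open Summit.QuantumFields.YangMills.Theorems.Prop7TrueAvgBudgetFlat (trueAvgBudget_smul_one_flat)

variable (F : T3Family) {n K : ℕ}

/-- ★★★ **THE CENTRAL SECTOR OF (QB) AT `W ∈ 𝔘_k(ε₀)`.**  Per `L > 1` an L-only `Cq ≥ 0` such that for every member `F` with `F.L = L`, `n < K`, `0 < e`, `10⁷L³e ≤ 1`,
`W ∈ RegPr F n K e`, every family `Q` satisfying (QB)'s displayed recursion along `W̄^{(·)}`, every `Cq′ ≥ 0` and every scalar bond field `c`:
`Σ_{ĉ} ‖Q (K−n) (c·1) ĉ‖² ≤ 2·Σ_{c′} ‖frobEquiv⁻¹(QTw W (c·1) c′)‖² + Cq·L^{K−n}·(CURL_HS(W, c·1) + DIV_HS(W, c·1)) + Cq′·e·(L^{K−n})⁻¹·Σ_b ‖c b·1‖²` —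
px10 ✓`trueAvgBudget_smul_one_of_flat` ∘ px19 ✓`trueAvgBudget_smul_one_flat` ∘ ✓`exists_trueLinIter_family 1`.
[cite: Balaban1985BackgroundPropagators, (3.4) p.391, (3.8) p.392, (3.13)-(3.15) p.393; Balaban1984PropagatorsI, (1.18)-(1.21) pp.19-21; Balaban1985Variational, (14) p.280, (44) p.285] -/
theorem trueAvgBudget_smul_one_of_regPr : ∀ (L : ℕ), 1 < L → ∃ Cq : ℝ, 0 ≤ Cq ∧
    ∀ (F : T3Family), F.L = L → ∀ (n K : ℕ) (hnK : n < K) (e : ℝ) (_he : 0 < e) (_hε : 10 ^ 7 * (F.L : ℝ) ^ 3 * e ≤ 1)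
      (W : GaugeField (F.P K) 0 (Matrix.specialUnitaryGroup (Fin 2) ℂ)), RegPr F n K e W →
      ∀ (Q : (k : ℕ) → (PBond (F.P K) 0 → Matrix (Fin 2) (Fin 2) ℂ) → PBond (F.P K) k → Matrix (Fin 2) (Fin 2) ℂ),
      (∀ Y, Q 0 Y = Y) →
      (∀ (k : ℕ) (Y : PBond (F.P K) 0 → Matrix (Fin 2) (Fin 2) ℂ) (c : PBond (F.P K) (k + 1)), Q (k + 1) Y c
        = (fderiv ℂ (eml : (Idx (F.P K) → Matrix (Fin 2) (Fin 2) ℂ) → Matrix (Fin 2) (Fin 2) ℂ)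
              (fun i => ((loopHol (Averaging.iter (fun i => blockAvg (P := (F.P K)) (j := i) (expMeanLogSU (n := Fin 2))) k W) c i : Matrix.specialUnitaryGroup (Fin 2) ℂ) : Matrix (Fin 2) (Fin 2) ℂ))
              (fun i => covWalkSum (Averaging.iter (fun i => blockAvg (P := (F.P K)) (j := i) (expMeanLogSU (n := Fin 2))) k W) (Q k Y) (walk (emb c.src) (loopWord (F.P K).L c.dir (off i.1) i.2.1 i.2.2))
                * ((loopHol (Averaging.iter (fun i => blockAvg (P := (F.P K)) (j := i) (expMeanLogSU (n := Fin 2))) k W) c i : Matrix.specialUnitaryGroup (Fin 2) ℂ) : Matrix (Fin 2) (Fin 2) ℂ))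
              * star ((corr (expMeanLogSU (n := Fin 2)) (Averaging.iter (fun i => blockAvg (P := (F.P K)) (j := i) (expMeanLogSU (n := Fin 2))) k W) c : Matrix.specialUnitaryGroup (Fin 2) ℂ) : Matrix (Fin 2) (Fin 2) ℂ)
            + ((corr (expMeanLogSU (n := Fin 2)) (Averaging.iter (fun i => blockAvg (P := (F.P K)) (j := i) (expMeanLogSU (n := Fin 2))) k W) c : Matrix.specialUnitaryGroup (Fin 2) ℂ) : Matrix (Fin 2) (Fin 2) ℂ)
              * covWalkSum (Averaging.iter (fun i => blockAvg (P := (F.P K)) (j := i) (expMeanLogSU (n := Fin 2))) k W) (Q k Y) (walk (emb c.src) (List.replicate (F.P K).L (c.dir, true)))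
              * star ((corr (expMeanLogSU (n := Fin 2)) (Averaging.iter (fun i => blockAvg (P := (F.P K)) (j := i) (expMeanLogSU (n := Fin 2))) k W) c : Matrix.specialUnitaryGroup (Fin 2) ℂ) : Matrix (Fin 2) (Fin 2) ℂ))) →
      ∀ (Cq' : ℝ), 0 ≤ Cq' → ∀ (c : PBond (F.P K) 0 → ℂ),
        ∑ c' : PBond (F.P K) (K - n), ‖Q (K - n) (fun b => c b • (1 : Matrix (Fin 2) (Fin 2) ℂ)) c'‖ ^ 2
          ≤ 2 * (∑ c' : PBond (F.P n) 0, ‖(frobEquiv.symm (QTw F n K hnK.le W (fun b => c b • (1 : Matrix (Fin 2) (Fin 2) ℂ)) c') : W₂)‖ ^ 2)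
            + Cq * (F.L : ℝ) ^ (K - n) * ((∑ x : Site (F.P K) 0, ∑ μ : Fin (F.P K).d, ∑ ν : Fin (F.P K).d,
                  (if μ < ν then ∑ j : Fin 2, ∑ k : Fin 2,
                    ‖(curl (torusT (F.P K) 0) (fun κ z => unitsField (toUField W) ⟨z, κ⟩) (fun κ z => c ⟨z, κ⟩ • (1 : Matrix (Fin 2) (Fin 2) ℂ)) μ ν x) j k‖ ^ 2 else 0))
                + (∑ x : Site (F.P K) 0, ∑ j : Fin 2, ∑ k : Fin 2,
                  ‖(divB (torusT (F.P K) 0) (fun κ z => unitsField (toUField W) ⟨z, κ⟩) (fun κ z => c ⟨z, κ⟩ • (1 : Matrix (Fin 2) (Fin 2) ℂ)) x) j k‖ ^ 2))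
            + Cq' * e * ((F.L : ℝ) ^ (K - n))⁻¹ * (∑ b : PBond (F.P K) 0, ‖c b • (1 : Matrix (Fin 2) (Fin 2) ℂ)‖ ^ 2) := by
  intro L hL
  obtain ⟨Cq, hCq, hflat⟩ := trueAvgBudget_smul_one_flat L hL
  refine ⟨Cq, hCq, ?_⟩
  intro F hF n K hnK e he hε W hreg Q hQ0 hQs Cq' hCq' c
  -- the flat true-linearised family
  obtain ⟨Q₁, hQ0₁, hQs₁⟩ := exists_trueLinIter_family (N := 2) (1 : GaugeField (F.P K) 0 (Matrix.specialUnitaryGroup (Fin 2) ℂ))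
  exact trueAvgBudget_smul_one_of_flat F hnK he hε W hreg Q Q₁ hQ0 hQs hQ0₁ hQs₁ Cq Cq' c
    (hflat F hF n K hnK Q₁ hQ0₁ hQs₁ Cq' e (mul_nonneg hCq' he.le) c)

end Summit.QuantumFields.YangMills.Theorems.Prop7TrueAvgBudgetCentralRegPr

end
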